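import Summits.BirchSwinnertonDyer.BirchSwinnertonDyer.Theorems.EisensteinDepletionAtTwoStarGO2PrimeSqArith
import HarnessLib

/-!
# The prime-square edge of crux `StarGO2` / `StarOptB` (items stmt-BirchSwinnertonDyer-24444 / 24445),
# arithmetic half, TYPE II: the formal `2`-torsion normal form at an additive odd prime `p` also forces
# `p ∈ {7, 17}` or `p ≡ 1 (mod 8)`

Companion of `Theorems/EisensteinDepletionAtTwoStarGO2PrimeSqDiophantine.lean` (type I = the rational
`2`-torsion point is étale at `2`). Here the point is FORMAL at `2` (type II of the Setzer–Ivorra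
normalisation: `y² = x³ + 2A₁x² + Bx`, `B` odd, `A₁ ≡ 3 (mod 4)`), so `B²(A₁² − B) = ±64pⁿ`, and additivity
at `p` reads `p ∣ c₄/16 = 4A₁² − 3B`. Together the two files say: an elliptic curve over `ℚ` of conductor `p²`
(`p` odd) with ANY rational point of order `2` has `p = 7`, `p = 17` or `p ≡ 1 (mod 8)`
(curve side: `Theorems/EisensteinDepletionAtTwoStarGO2PrimeSqRationalTwoTorsion.lean`), which makes BOTH
research children of E1M (`StarGO2`, `StarOptB`) vacuous at conductor `p²`, `p ≡ ±3 (mod 8)`.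

* `PrimeSq.coreII` (strong induction on `n`): `a`, `B` odd, `p ∣ a`, `p ∣ B`, `B²(a² − B) = ±64pⁿ` ⟹
  `p = 7 ∨ p = 17 ∨ p ≡ 1 (mod 8)` (exits: `pa₁² ∈ {63, 65}` at `p = 7`; `(a₁ − 1)(a₁ + 1) = ±64pᵉ` and
  `(a₁ − 8)(a₁ + 8) = ±pᵏ` at `p = 17`; the Lebesgue–Nagell equation `a₁² + 64 = pᵏ`).
* `PrimeSq.typeII_classify`: the package consumed by the curve-side file.

HONEST FRAMING: elementary arithmetic toward ONE edge of two OPEN cruxes; neither `StarGO2`, `StarOptB` nor E1M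
is proved here; nothing reads an analytic rank; BSD is not proved by any of this.

References: [Setzer1975] B. Setzer, *Elliptic curves of prime conductor*, J. London Math. Soc. (2) 10 (1975)
367–378, §2; [Ivorra2004] W. Ivorra, Dissertationes Math. 429 (2004), §2.1; [Cohn1993] J. H. E. Cohn, *The
Diophantine equation x² + C = yⁿ*, Acta Arith. 65 (1993).
-/

set_option linter.dupNamespace false
set_option autoImplicit false

namespace Summit.BirchSwinnertonDyer.BirchSwinnertonDyer.Theorems.DepletionAtTwo

namespace PrimeSq

/-! ## §1 Small lemmas with the `2`-power factor `64` -/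

/-- An odd integer is coprime to `64`. [folklore] -/
theorem isCoprime_sixtyfour_of_odd {b : ℤ} (hb : Odd b) : IsCoprime b 64 := by
  obtain ⟨k, rfl⟩ := hb
  have h2 : IsCoprime (2 * k + 1) 2 := ⟨1, -k, by ring⟩
  have h64 : IsCoprime (2 * k + 1) (2 ^ 6) := h2.pow_right
  norm_num at h64
  exact h64

/-- An odd divisor of `±64pᵐ` prime to `p` is `±1`. [folklore] -/
theorem eq_one_or_neg_one_of_mul_eq64 {p : ℤ} (hp : Prime p) {b c : ℤ} {m : ℕ} (hodd : Odd b)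
    (hb : ¬ p ∣ b) (h : b * c = 64 * p ^ m ∨ b * c = -(64 * p ^ m)) : b = 1 ∨ b = -1 := by
  have hcop : IsCoprime b (64 * p ^ m) :=
    (isCoprime_sixtyfour_of_odd hodd).mul_right ((Prime.coprime_iff_not_dvd hp).mpr hb).symm.pow_right
  have hd : b ∣ 64 * p ^ m * 1 := by
    rw [mul_one]
    rcases h with h | h
    · exact ⟨c, h.symm⟩
    · exact ⟨-c, by linear_combination h⟩
  exact Int.isUnit_iff.mp (isUnit_of_dvd_one (hcop.dvd_of_dvd_mul_left hd))

/-- An odd divisor of `±64pᵐ` is `±pʲ`. [folklore] -/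
theorem eq_pow_of_odd_mul_eq64 {p : ℕ} (hp : p.Prime) {b c : ℤ} {m : ℕ} (hodd : Odd b)
    (h : b * c = 64 * (p : ℤ) ^ m ∨ b * c = -(64 * (p : ℤ) ^ m)) :
    ∃ j : ℕ, b = (p : ℤ) ^ j ∨ b = -((p : ℤ) ^ j) := by
  have hcop : IsCoprime b 64 := isCoprime_sixtyfour_of_odd hodd
  have hd : b ∣ 64 * (p : ℤ) ^ m := by
    rcases h with h | h
    · exact ⟨c, h.symm⟩
    · exact ⟨-c, by linear_combination h⟩
  exact eq_pow_or_neg_pow_of_dvd hp (hcop.dvd_of_dvd_mul_left hd)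

/-- Cancelling `pˢ` against `±64pᵐ` (`p` odd prime): if `pˢ·X = ±64pᵐ` then `s ≤ m` and
`X = ±64pᵐ⁻ˢ`. [folklore] -/
theorem of_pow_mul_eq64 {p : ℕ} (hp : p.Prime) (hp2 : p ≠ 2) {X : ℤ} {s m : ℕ}
    (h : (p : ℤ) ^ s * X = 64 * (p : ℤ) ^ m ∨ (p : ℤ) ^ s * X = -(64 * (p : ℤ) ^ m)) :
    s ≤ m ∧ (X = 64 * (p : ℤ) ^ (m - s) ∨ X = -(64 * (p : ℤ) ^ (m - s))) := by
  have hp' : Prime (p : ℤ) := Nat.prime_iff_prime_int.mp hp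
  have hp0 : (p : ℤ) ^ s ≠ 0 := pow_ne_zero _ (by exact_mod_cast hp.ne_zero)
  have hp64 : ¬ (p : ℤ) ∣ 64 := by
    intro h64
    have h2 : p ∣ 2 ^ 6 := by exact_mod_cast h64
    exact hp2 ((Nat.prime_dvd_prime_iff_eq hp Nat.prime_two).mp (hp.dvd_of_dvd_pow h2))
  have hcop : IsCoprime ((p : ℤ) ^ s) 64 := ((Prime.coprime_iff_not_dvd hp').mpr hp64).pow_left
  have hsm : s ≤ m := by
    have hdvd : (p : ℤ) ^ s ∣ 64 * (p : ℤ) ^ m := by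
      rcases h with h | h
      · exact ⟨X, h.symm⟩
      · exact ⟨-X, by linear_combination h⟩
    have hdvd' : (p : ℤ) ^ s ∣ (p : ℤ) ^ m := hcop.dvd_of_dvd_mul_left hdvd
    have hdvd'' : p ^ s ∣ p ^ m := by exact_mod_cast hdvd'
    exact (Nat.pow_dvd_pow_iff_le_right hp.one_lt).mp hdvd''
  refine ⟨hsm, ?_⟩
  have hpow : (p : ℤ) ^ m = (p : ℤ) ^ s * (p : ℤ) ^ (m - s) := by
    rw [← pow_add]; congr 1; omega
  rcases h with h | h
  · left; exact mul_left_cancel₀ hp0 (by rw [h, hpow]; ring)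
  · right; exact mul_left_cancel₀ hp0 (by rw [h, hpow]; ring)

/-- `pa² ∈ {63, 65}` with `p` prime and `a ≠ 0` forces `p = 7` (`a = ±3`). [folklore] -/
theorem eq_seven_of_mul_sq {p : ℕ} (hp : p.Prime) (hp2 : p ≠ 2) {a : ℤ} (ha : a ≠ 0)
    (key : (p : ℤ) * a ^ 2 = 63 ∨ (p : ℤ) * a ^ 2 = 65) : p = 7 := by
  have hp3 : (3 : ℤ) ≤ p := by have := hp.two_le; omega
  have hsqpos : 0 < a ^ 2 := by positivity
  have hsq65 : a ^ 2 ≤ 65 := by rcases key with k | k <;> nlinarith [sq_nonneg a]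
  have hb1 : a ≤ 9 := by nlinarith [sq_nonneg a]
  have hb2 : -9 ≤ a := by nlinarith [sq_nonneg a]
  interval_cases a <;> rcases key with k | k <;> norm_num at k <;>
    first
    | omega
    | (exfalso
       have h63 : p = 63 := by omega
       subst h63; exact absurd hp (by norm_num))
    | (exfalso
       have h65 : p = 65 := by omega
       subst h65; exact absurd hp (by norm_num))

/-! ## §2 The core, type II: `a`, `B` odd, `p ∣ a`, `p ∣ B`, `B²(a² − B) = ±64pⁿ` -/

/-- **Core of the prime-square edge, type II** (strong induction on `n`). For an odd prime `p`, odd `a`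
with `p ∣ a`, odd `B` with `p ∣ B` and `B²(a² − B) = ±64pⁿ`: `p = 7`, `p = 17` or `p ≡ 1 (mod 8)`.
[cite: Setzer1975, §2 (the same descent for prime conductor); Cohn1993 (x² + 64 = yⁿ)] -/
theorem coreII {p : ℕ} (hp : p.Prime) (hp2 : p ≠ 2) (n : ℕ) :
    ∀ (a B : ℤ), Odd a → Odd B → (p : ℤ) ∣ a → (p : ℤ) ∣ B →
      (B ^ 2 * (a ^ 2 - B) = 64 * (p : ℤ) ^ n ∨ B ^ 2 * (a ^ 2 - B) = -(64 * (p : ℤ) ^ n)) →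
      p = 7 ∨ p = 17 ∨ p % 8 = 1 := by
  induction n using Nat.strong_induction_on with
  | _ n ih =>
  intro a B ha hB hpa hpB hE
  have hp' : Prime (p : ℤ) := Nat.prime_iff_prime_int.mp hp
  have hppos : (0 : ℤ) < p := by exact_mod_cast hp.pos
  obtain ⟨a₁, rfl⟩ := hpa
  obtain ⟨B₁, rfl⟩ := hpB
  have ha₁ : Odd a₁ := (Int.odd_mul.mp ha).2
  have hB₁ : Odd B₁ := (Int.odd_mul.mp hB).2
  -- `p³ · B₁²(pa₁² − B₁) = ±64pⁿ`
  have hX : (p : ℤ) ^ 3 * (B₁ ^ 2 * (p * a₁ ^ 2 - B₁)) = 64 * (p : ℤ) ^ n ∨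
      (p : ℤ) ^ 3 * (B₁ ^ 2 * (p * a₁ ^ 2 - B₁)) = -(64 * (p : ℤ) ^ n) := by
    rcases hE with h | h
    · left; linear_combination h
    · right; linear_combination h
  obtain ⟨h3n, hE₁⟩ := of_pow_mul_eq64 hp hp2 hX
  set n₁ := n - 3 with hn₁
  by_cases hpB₁ : (p : ℤ) ∣ B₁
  · obtain ⟨B₂, rfl⟩ := hpB₁
    have hB₂ : Odd B₂ := (Int.odd_mul.mp hB₁).2
    -- `p³ · B₂²(a₁² − B₂) = ±64pⁿ¹`
    have hY : (p : ℤ) ^ 3 * (B₂ ^ 2 * (a₁ ^ 2 - B₂)) = 64 * (p : ℤ) ^ n₁ ∨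
        (p : ℤ) ^ 3 * (B₂ ^ 2 * (a₁ ^ 2 - B₂)) = -(64 * (p : ℤ) ^ n₁) := by
      rcases hE₁ with h | h
      · left; linear_combination h
      · right; linear_combination h
    obtain ⟨h3n₁, hE₂⟩ := of_pow_mul_eq64 hp hp2 hY
    set n₂ := n₁ - 3 with hn₂
    by_cases hpB₂ : (p : ℤ) ∣ B₂
    · by_cases hpa₁ : (p : ℤ) ∣ a₁
      · -- descent
        exact ih n₂ (by omega) a₁ B₂ ha₁ hB₂ hpa₁ hpB₂ hE₂
      · -- `p ∤ a₁² − B₂`; `B₂ = ±pᵏ` (`k ≥ 1`), `a₁² − B₂ = ±64`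
        have hnd : ¬ (p : ℤ) ∣ a₁ ^ 2 - B₂ := by
          intro h
          have hA2 : (p : ℤ) ∣ a₁ ^ 2 := by
            have := dvd_add h hpB₂
            rwa [sub_add_cancel] at this
          exact hpa₁ (hp'.dvd_of_dvd_pow hA2)
        obtain ⟨k, hk⟩ := eq_pow_of_odd_mul_eq64 hp hB₂ (c := B₂ * (a₁ ^ 2 - B₂)) (m := n₂) (by
          rcases hE₂ with h | h
          · left; linear_combination h
          · right; linear_combination h)
        have hB₂sq : B₂ ^ 2 = (p : ℤ) ^ (2 * k) := by
          rcases hk with hk | hk <;> rw [hk] <;> ring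
        have hZ : (p : ℤ) ^ (2 * k) * (a₁ ^ 2 - B₂) = 64 * (p : ℤ) ^ n₂ ∨
            (p : ℤ) ^ (2 * k) * (a₁ ^ 2 - B₂) = -(64 * (p : ℤ) ^ n₂) := by
          rw [← hB₂sq]; exact hE₂
        obtain ⟨h2k, hW⟩ := of_pow_mul_eq64 hp hp2 hZ
        have hn2k : n₂ - 2 * k = 0 := by
          by_contra hne
          apply hnd
          rcases hW with h | h <;> rw [h]
          · exact (dvd_pow_self (p : ℤ) hne).mul_left 64
          · exact ((dvd_pow_self (p : ℤ) hne).mul_left 64).neg_right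
        rw [hn2k, pow_zero, mul_one] at hW
        -- `a₁² − B₂ = ±64` with `B₂ = ±pᵏ`
        rcases hk with hk | hk
        · -- `B₂ = pᵏ`: `a₁² ∓ 64 = pᵏ`
          rcases hW with h | h
          · -- `(a₁ − 8)(a₁ + 8) = pᵏ`
            have h17 := sq_sub_sixtyfour hp hp2 (A := a₁) (l := k) (Or.inl (by
              linear_combination h + hk))
            exact Or.inr (Or.inl h17.1)
          · -- `a₁² + 64 = pᵏ`: Lebesgue–Nagell
            have hLN : a₁ ^ 2 + 64 = (p : ℤ) ^ k := by linear_combination h + hk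
            rcases Literature.NumberTheory.DiophantineGeometry.sq_add_sixtyfour_eq_prime_pow hp hp2 k a₁
                hLN with hk1' | ⟨-, h17⟩
            · subst hk1'
              right; right
              have h8 := sq_emod_eight_of_odd ha₁
              rw [pow_one] at hLN
              generalize a₁ ^ 2 = s at hLN h8
              omega
            · exact Or.inr (Or.inl h17)
        · -- `B₂ = −pᵏ`: `a₁² + pᵏ = ±64`
          rcases hW with h | h
          · -- `a₁² − 64 = −pᵏ`
            have h17 := sq_sub_sixtyfour hp hp2 (A := a₁) (l := k) (Or.inr (by
              linear_combination h + hk))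
            exact Or.inr (Or.inl h17.1)
          · -- `a₁² + 64 = −pᵏ < 0`: impossible
            exfalso
            nlinarith [sq_nonneg a₁, pow_pos hppos k]
    · -- `p ∤ B₂`: `B₂ = ±1`
      have h1 := eq_one_or_neg_one_of_mul_eq64 hp' hB₂ hpB₂ (c := B₂ * (a₁ ^ 2 - B₂)) (m := n₂) (by
        rcases hE₂ with h | h
        · left; linear_combination h
        · right; linear_combination h)
      rcases h1 with rfl | rfl
      · -- `B₂ = 1`: `(a₁ − 1)(a₁ + 1) = ±64pⁿ²`
        have h17 := sq_sub_one hp hp2 (A := a₁) (l := n₂) (by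
          rcases hE₂ with h | h
          · left; linear_combination h
          · right; linear_combination h)
        exact Or.inr (Or.inl h17.1)
      · -- `B₂ = −1`: `a₁² + 1 = ±64pⁿ²` is impossible modulo `4`
        exfalso
        have h4 : a₁ ^ 2 % 4 = 1 := Int.sq_mod_four_eq_one_of_odd ha₁
        have h64 : (4 : ℤ) ∣ 64 * (p : ℤ) ^ n₂ := ⟨16 * (p : ℤ) ^ n₂, by ring⟩
        have e : (-1 : ℤ) ^ 2 * (a₁ ^ 2 - -1) = a₁ ^ 2 + 1 := by ring
        have h41 : (4 : ℤ) ∣ a₁ ^ 2 + 1 := by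
          rcases hE₂ with h | h
          · rw [← e, h]; exact h64
          · rw [← e, h]; exact h64.neg_right
        generalize a₁ ^ 2 = s at h4 h41
        omega
  · -- `p ∤ B₁`: `B₁ = ±1`, then `n₁ = 0` and `pa₁² ∈ {63, 65}`
    have h1 := eq_one_or_neg_one_of_mul_eq64 hp' hB₁ hpB₁ (c := B₁ * (p * a₁ ^ 2 - B₁)) (m := n₁) (by
      rcases hE₁ with h | h
      · left; linear_combination h
      · right; linear_combination h)
    have hB₁sq : B₁ ^ 2 = 1 := by rcases h1 with rfl | rfl <;> norm_num
    rcases Nat.eq_zero_or_pos n₁ with hn0 | hn0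
    · rw [hn0, pow_zero, mul_one] at hE₁
      left
      have ha₁0 : a₁ ≠ 0 := by rintro rfl; exact absurd ha₁ (by decide)
      have hsqpos : 0 < a₁ ^ 2 := by positivity
      have hpos : 0 < (p : ℤ) * a₁ ^ 2 := mul_pos hppos hsqpos
      refine eq_seven_of_mul_sq hp hp2 ha₁0 ?_
      rcases h1 with rfl | rfl <;> rcases hE₁ with h | h
      · right; linear_combination h
      · exfalso; nlinarith [h]
      · left; linear_combination h
      · exfalso; nlinarith [h]
    · exfalso
      have hn1 : n₁ ≠ 0 := by omega
      have hd : (p : ℤ) ∣ p * a₁ ^ 2 - B₁ := by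
        rcases hE₁ with h | h
        · rw [hB₁sq, one_mul] at h; rw [h]; exact (dvd_pow_self _ hn1).mul_left 64
        · rw [hB₁sq, one_mul] at h; rw [h]; exact ((dvd_pow_self _ hn1).mul_left 64).neg_right
      have hB : (p : ℤ) ∣ B₁ := by
        have := dvd_sub (dvd_mul_right (p : ℤ) (a₁ ^ 2)) hd
        rwa [sub_sub_cancel] at this
      exact hpB₁ hB

/-! ## §3 The type-II package at an additive odd prime -/

/-- **Type II at an additive odd prime, classification.** If `B²((2A₁)² − 4B) = ±2⁸pⁿ` (`p` an odd prime),
`p ∣ (2A₁)² − 3B` (additive reduction: `p ∣ c₄`), `A₁ ≡ 3 (mod 4)` and `B` odd (type II: the `2`-torsion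
point is formal at `2`), then `p = 7`, `p = 17` or `p ≡ 1 (mod 8)`. (`B²(A₁² − B) = ±64pⁿ`; `p ∤ B` gives
`B = ±1` and `(A₁ − 1)(A₁ + 1) = ±64pⁿ`, i.e. `p = 17`, or `A₁² + 1 ≡ 0 (mod 4)`; `p ∣ B` gives `p ∣ A₁`
and `coreII`.) [cite: Setzer1975, §2; Ivorra2004, §2.1] -/
theorem typeII_classify {p : ℕ} (hp : p.Prime) (hp2 : p ≠ 2) {A₁ B : ℤ} {n : ℕ}
    (hD : B ^ 2 * ((2 * A₁) ^ 2 - 4 * B) = 2 ^ 8 * (p : ℤ) ^ n ∨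
      B ^ 2 * ((2 * A₁) ^ 2 - 4 * B) = -(2 ^ 8 * (p : ℤ) ^ n))
    (hC : (p : ℤ) ∣ (2 * A₁) ^ 2 - 3 * B) (hA : A₁ % 4 = 3) (hB : Odd B) :
    p = 7 ∨ p = 17 ∨ p % 8 = 1 := by
  have hp' : Prime (p : ℤ) := Nat.prime_iff_prime_int.mp hp
  have hA₁odd : Odd A₁ := Int.odd_iff.mpr (by omega)
  -- `B²(A₁² − B) = ±64pⁿ`
  have hE : B ^ 2 * (A₁ ^ 2 - B) = 64 * (p : ℤ) ^ n ∨ B ^ 2 * (A₁ ^ 2 - B) = -(64 * (p : ℤ) ^ n) := by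
    rcases hD with h | h
    · left; exact mul_left_cancel₀ (by norm_num : (4 : ℤ) ≠ 0) (by linear_combination h)
    · right; exact mul_left_cancel₀ (by norm_num : (4 : ℤ) ≠ 0) (by linear_combination h)
  by_cases hpB : (p : ℤ) ∣ B
  · -- `p ∣ B`, so `p ∣ 4A₁²`, `p ∣ A₁`: the core
    have hpA : (p : ℤ) ∣ A₁ := by
      have h3 : (p : ℤ) ∣ 3 * B := dvd_mul_of_dvd_right hpB 3
      have h4A : (p : ℤ) ∣ 4 * A₁ ^ 2 := by
        have := dvd_add hC h3
        have e : (2 * A₁) ^ 2 - 3 * B + 3 * B = 4 * A₁ ^ 2 := by ring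
        rwa [e] at this
      rcases hp'.dvd_or_dvd h4A with h4 | h4
      · exfalso
        have h2 : p ∣ 2 ^ 2 := by exact_mod_cast h4
        exact hp2 ((Nat.prime_dvd_prime_iff_eq hp Nat.prime_two).mp (hp.dvd_of_dvd_pow h2))
      · exact hp'.dvd_of_dvd_pow h4
    exact coreII hp hp2 n A₁ B hA₁odd hB hpA hpB hE
  · -- `p ∤ B`: `B = ±1`
    have h1 := eq_one_or_neg_one_of_mul_eq64 hp' hB hpB (c := B * (A₁ ^ 2 - B)) (m := n) (by
      rcases hE with h | h
      · left; linear_combination h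
      · right; linear_combination h)
    rcases h1 with rfl | rfl
    · -- `B = 1`: `(A₁ − 1)(A₁ + 1) = ±64pⁿ` ⟹ `p = 17`
      have h17 := sq_sub_one hp hp2 (A := A₁) (l := n) (by
        rcases hE with h | h
        · left; linear_combination h
        · right; linear_combination h)
      exact Or.inr (Or.inl h17.1)
    · -- `B = −1`: `A₁² + 1 = ±64pⁿ` is impossible modulo `4`
      exfalso
      have h4 : A₁ ^ 2 % 4 = 1 := Int.sq_mod_four_eq_one_of_odd hA₁odd
      have h64 : (4 : ℤ) ∣ 64 * (p : ℤ) ^ n := ⟨16 * (p : ℤ) ^ n, by ring⟩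
      have e : (-1 : ℤ) ^ 2 * (A₁ ^ 2 - -1) = A₁ ^ 2 + 1 := by ring
      have h41 : (4 : ℤ) ∣ A₁ ^ 2 + 1 := by
        rcases hE with h | h
        · rw [← e, h]; exact h64
        · rw [← e, h]; exact h64.neg_right
      generalize A₁ ^ 2 = s at h4 h41
      omega

end PrimeSq

end Summit.BirchSwinnertonDyer.BirchSwinnertonDyer.Theorems.DepletionAtTwo
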